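import Summits.QuantumFields.GaugeBoot.PlanarLoopEquationsZd
import HarnessLib

/-!
# A planar (`N = ∞`) Kazakov–Zheng certificate bounds `U(N)` / `SU(N)` lattice Yang–Mills at EVERY finite `N`, up to an explicit defect (gauge-boot, large-`N` supplement 4)

HONEST FRAMING (cell `pub-gaugeboot`, page 1 of every file): the venture produces certified bounds
on lattice expectations at stated coupling, gauge group, dimension and torus size; NOT a mass gap,
NOT a continuum limit, NOT a string tension; NOT large `N` unless marked CONDITIONAL; NOT
Yang–Mills-summit-bearing (barriers `FixedCouplingUltralocality`, `PerturbativeInvisibility`).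
This file says what a PLANAR certificate proves about the finite-`N` theory; it certifies no number
and no planar certificate of the cell exists in the tree.

## The object

A dual certificate of Kazakov–Zheng's planar SDP (arXiv:2203.11360 §3: planar loop equations,
correlation-matrix positivity, the convex relaxation `[[1, Wᵀ], [W, Q]] ⪰ 0`, symmetry
identifications) for the claim "`obj(W) ≤ bound`" is an IDENTITY between affine functionals of
the planar data `(W, Q)` (`PlanarCertificate.IsValid`):

`bound − obj(W) = Σ_r y_r · planarRow_r(W, Q) + Σ_j ⟨c_j c_jᵀ, Gram_j(W)⟩ + Σ_s ⟨m_s m_sᵀ, [[1,Wᵀ],[W,Q]]⟩ + Σ_e z_e · lin_e(W, Q)`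

with rank-one (factorised) positive multipliers — the certsdp discipline of the cell (PSD
multipliers as explicit factors).  At `N = ∞` every term on the right is `= 0` or `≥ 0` on feasible
data, whence `obj ≤ bound` (`PlanarCertificate.obj_le_bound_of_feasible`, the planar soundness).

## The theorem (finite `N`)

Read the same identity on the planar data `(loopW μ, loopQ μ)` of a finite-`N` STATE `μ` on `ℤ^d`
(pair expectations for products).  Term by term (supplements 1–3): Gram blocks `≥ 0` for every
probability measure (`ClassBWords.sum_mul_integral_wordLoopZd_nonneg`); relaxation blocks
`≥ −E(Σ_A m_{sA} Im t_{ℓ_A})²`; rows `= 0` for `U(N)` and bounded by `length/N² + |βt| Σ|Γ|` for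
`SU(N)`; identification rows `= 0` by hypothesis (whatever lattice symmetries the state has).  Hence

* ★★★ `PlanarCertificate.obj_loopW_le_uN` — **`U(N)`, every `N`, every Haar-shift state at tree
  coupling `β` with `β/N = βt`: `obj(W_μ) ≤ bound + Σ_s E_μ(Σ_A m_{sA} Im t_{ℓ_A})²`**;
* ★★★ `PlanarCertificate.obj_loopW_le_suN` — **`SU(N)`: the same plus
  `Σ_r |y_r| (length(w_r)/N² + |βt| Σ_{ν,ε} |Γ_μ(w_r, P̃_{ν,ε})|)`**;
* ★★ the crude forms `…_le_uN_card` / `…_le_suN_card` in the single-loop second moments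
  `Γ_μ(ℓ_A, ℓ_A) = E_μ[(Im t_{ℓ_A})²]` (and `Γ(w_r, w_r)` via `Γ(A,B)² ≤ Γ(A,A)`).

So: A PLANAR CERTIFICATE IS A BOUND ON THE FINITE-`N` THEORY UP TO A DEFECT CONTROLLED BY THE
SECOND MOMENTS OF THE IMAGINARY PARTS OF THE FINITELY MANY LOOPS IT USES (+ `O(1/N²)` for `SU(N)`) —
exactly the quantities large-`N` factorisation kills (sequel: `PlanarBootstrapLargeN`).  Nothing is
claimed about the size of the defect at any fixed `N`, nor that any planar certificate exists.
[folklore] conic bookkeeping; Kazakov–Zheng arXiv:2203.11360 §3 for the SDP.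
-/

noncomputable section

open MeasureTheory
open scoped BigOperators
open Literature.Probability.LatticeModels (Site)
open Literature.MathematicalPhysics.QuantumLattice

namespace Summit.QuantumFields.GaugeBoot

variable {d N : ℕ}

/-! ## Gram (correlation-matrix) blocks -/

/-- **A correlation-matrix block paired with a rank-one multiplier** `c cᵀ`: for closed words
`O_1, …, O_n` at the base point, `⟨c cᵀ, (W(O_i⁻¹ O_j))_{ij}⟩ = Σ_{i,j} c_i c_j W(O_i⁻¹ · O_j)`
(Kazakov–Zheng's "Hermitian conjugate = reversed path" positivity, §3.1). [cite: KazakovZheng2023, §3.1] -/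
def gramPairing {n : ℕ} (O : Fin n → Word d) (c : Fin n → ℝ) (W : Word d → ℝ) : ℝ :=
  ∑ i, ∑ j, c i * c j * W ((O i).reverse ++ O j)

/-- **Gram blocks are sound at every `N`**: on the data `W = loopW μ` of ANY probability measure on
`ℤ^d` configurations (any compact `G`, continuous `ρ`), every rank-one Gram pairing of closed words
is `≥ 0`. [folklore] -/
theorem gramPairing_loopW_nonneg {G : Type*} [Group G] [TopologicalSpace G] [IsTopologicalGroup G] [CompactSpace G]
    [MeasurableSpace G] [BorelSpace G] (ρ : G →* Matrix (Fin N) (Fin N) ℂ) (hρ : Continuous ρ)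
    (μ : Measure (LGConfig d G)) [IsProbabilityMeasure μ] (x : Site d) {n : ℕ} (O : Fin n → Word d)
    (hO : ∀ i, Word.endpointZd x (O i) = x) (c : Fin n → ℝ) :
    0 ≤ gramPairing O c (loopW ρ μ x) := by
  simp only [gramPairing, loopW_eq_integral_wordLoopZd ρ hρ μ]
  exact sum_mul_integral_wordLoopZd_nonneg ρ hρ μ x O hO c

/-! ## Planar certificates -/

/-- **A planar (Kazakov–Zheng) certificate** for `obj ≤ bound` at 't Hooft coupling `βt`, in
factorised (rank-one multiplier) form: rows = planar loop equations of marked words `(axis, word)`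
with multipliers; Gram blocks = closed words with one factor vector each (a PSD multiplier of rank
`k` is `k` blocks on the same words); the relaxation block on the loops `shorLoop` with rank-one
factors `(m₀, m)`; extra linear identities `lin` (symmetry identifications, `Q([],C) = W(C)`, …)
with multipliers; the objective `obj` and the `bound`. Data only. [cite: KazakovZheng2023, §3] -/
structure PlanarCertificate (d : ℕ) where
  /-- 't Hooft-normalised coupling of the rows (`β/N` for the tree coupling `β`). -/
  βt : ℝ
  /-- number of loop-equation rows -/
  nR : ℕ
  /-- axis of the marked link of row `r` -/
  rowAxis : Fin nR → Fin d
  /-- marked word of row `r` -/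
  rowWord : Fin nR → Word d
  /-- multiplier of row `r` -/
  rowMult : Fin nR → ℝ
  /-- number of (rank-one) Gram blocks -/
  nJ : ℕ
  /-- size of Gram block `j` -/
  gramSize : Fin nJ → ℕ
  /-- closed words of Gram block `j` -/
  gramWord : (j : Fin nJ) → Fin (gramSize j) → Word d
  /-- factor vector of Gram block `j` -/
  gramVec : (j : Fin nJ) → Fin (gramSize j) → ℝ
  /-- number of loops entering the relaxation block -/
  nI : ℕ
  /-- the loops of the relaxation block -/
  shorLoop : Fin nI → Word d
  /-- number of rank-one relaxation multipliers -/
  nS : ℕ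
  /-- constant component `m₀` of relaxation factor `s` -/
  shorConst : Fin nS → ℝ
  /-- loop components `m_A` of relaxation factor `s` -/
  shorVec : Fin nS → Fin nI → ℝ
  /-- number of extra linear identities -/
  nE : ℕ
  /-- the extra linear identities (functionals of the planar data vanishing on the target states) -/
  lin : Fin nE → (Word d → ℝ) → (Word d → Word d → ℝ) → ℝ
  /-- their multipliers -/
  linMult : Fin nE → ℝ
  /-- the objective (any function of the single-loop data; affine in practice) -/
  obj : (Word d → ℝ) → ℝ
  /-- the certified constant -/
  bound : ℝ

namespace PlanarCertificate

variable (P : PlanarCertificate d)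

/-- The relaxation pairing of factor `s` on planar data. [cite: KazakovZheng2023, §3.2] -/
def shorTerm (s : Fin P.nS) (W : Word d → ℝ) (Q : Word d → Word d → ℝ) : ℝ :=
  shorPairing (P.shorConst s) (P.shorVec s) (fun A => W (P.shorLoop A)) (fun A B => Q (P.shorLoop A) (P.shorLoop B))

/-- The right-hand side of the certificate identity on planar data `(W, Q)`. [cite: KazakovZheng2023, §3] -/
def rhs (W : Word d → ℝ) (Q : Word d → Word d → ℝ) : ℝ :=
  (∑ r, P.rowMult r * planarRow P.βt (P.rowAxis r) (P.rowWord r) W Q) +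
    (∑ j, gramPairing (P.gramWord j) (P.gramVec j) W) +
    (∑ s, P.shorTerm s W Q) +
    ∑ e, P.linMult e * P.lin e W Q

/-- **Validity**: the certificate identity `bound − obj(W) = rhs(W, Q)` holds for ALL planar data
(an identity of affine functionals — what a certificate checker verifies). [cite: KazakovZheng2023, §3] -/
def IsValid : Prop := ∀ (W : Word d → ℝ) (Q : Word d → Word d → ℝ), P.bound - P.obj W = P.rhs W Q

/-- **Planar soundness (`N = ∞`, for the record)**: on planar data satisfying the rows, the extra
identities, Gram positivity (for the certificate's factors) and the relaxation, a valid certificate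
gives `obj ≤ bound`. [cite: KazakovZheng2023, §3] -/
theorem obj_le_bound_of_feasible (hP : P.IsValid) (W : Word d → ℝ) (Q : Word d → Word d → ℝ)
    (hrow : ∀ r, planarRow P.βt (P.rowAxis r) (P.rowWord r) W Q = 0)
    (hgram : ∀ j, 0 ≤ gramPairing (P.gramWord j) (P.gramVec j) W)
    (hshor : IsRelaxationFeasible (fun A => W (P.shorLoop A)) (fun A B => Q (P.shorLoop A) (P.shorLoop B)))
    (hlin : ∀ e, P.lin e W Q = 0) : P.obj W ≤ P.bound := by
  have h := hP W Q
  simp only [rhs, hrow, mul_zero, Finset.sum_const_zero, zero_add, hlin, add_zero] at h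
  have h1 : 0 ≤ ∑ j, gramPairing (P.gramWord j) (P.gramVec j) W := Finset.sum_nonneg fun j _ => hgram j
  have h2 : 0 ≤ ∑ s, P.shorTerm s W Q := Finset.sum_nonneg fun s _ => hshor _ _
  linarith

/-- **The abstract finite-`N` transfer**: on ANY planar data, a valid certificate gives
`obj ≤ bound + Σ_r |y_r| ε_r + Σ_s γ_s` as soon as the rows hold up to `ε_r`, the Gram blocks are
non-negative, the relaxation terms are `≥ −γ_s` and the extra identities hold. [folklore] -/
theorem obj_le_of_defects (hP : P.IsValid) (W : Word d → ℝ) (Q : Word d → Word d → ℝ)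
    (ε : Fin P.nR → ℝ) (γ : Fin P.nS → ℝ)
    (hrow : ∀ r, |planarRow P.βt (P.rowAxis r) (P.rowWord r) W Q| ≤ ε r)
    (hgram : ∀ j, 0 ≤ gramPairing (P.gramWord j) (P.gramVec j) W)
    (hshor : ∀ s, -γ s ≤ P.shorTerm s W Q) (hlin : ∀ e, P.lin e W Q = 0) :
    P.obj W ≤ P.bound + ∑ r, |P.rowMult r| * ε r + ∑ s, γ s := by
  have h := hP W Q
  simp only [rhs, hlin, mul_zero, Finset.sum_const_zero, add_zero] at h
  have h1 : 0 ≤ ∑ j, gramPairing (P.gramWord j) (P.gramVec j) W := Finset.sum_nonneg fun j _ => hgram j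
  have h2 : -(∑ s, γ s) ≤ ∑ s, P.shorTerm s W Q := by
    rw [← Finset.sum_neg_distrib]; exact Finset.sum_le_sum fun s _ => hshor s
  have h3 : -(∑ r, |P.rowMult r| * ε r) ≤ ∑ r, P.rowMult r * planarRow P.βt (P.rowAxis r) (P.rowWord r) W Q := by
    rw [← Finset.sum_neg_distrib]
    refine Finset.sum_le_sum fun r _ => ?_
    have := abs_le.1 ((abs_mul _ _).le.trans (mul_le_mul_of_nonneg_left (hrow r) (abs_nonneg (P.rowMult r))))
    linarith [this.1]
  linarith

/-! ## The transfer to finite-`N` states on `ℤ^d` -/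

section States

variable {G : Type*} [Group G] [TopologicalSpace G] [IsTopologicalGroup G] [CompactSpace G]
  [MeasurableSpace G] [BorelSpace G] (ρ : G →* Matrix (Fin N) (Fin N) ℂ)

/-- The relaxation defect of factor `s` on the state `μ`: `γ_s(μ) = E_μ(Σ_A m_{sA} Im t_{ℓ_A})²`. [folklore] -/
def shorDefect (μ : Measure (LGConfig d G)) (x : Site d) (s : Fin P.nS) : ℝ :=
  ∫ U, (∑ A, P.shorVec s A * (loopTrZd ρ x (P.shorLoop A) U).im) ^ 2 ∂μ

omit [TopologicalSpace G] [IsTopologicalGroup G] [CompactSpace G] [BorelSpace G] in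
/-- The relaxation defect is non-negative. [folklore] -/
theorem shorDefect_nonneg (μ : Measure (LGConfig d G)) (x : Site d) (s : Fin P.nS) : 0 ≤ P.shorDefect ρ μ x s :=
  integral_nonneg fun _ => sq_nonneg _

/-- The relaxation defect in the single-loop second moments:
`γ_s(μ) ≤ nI · Σ_A m_{sA}² Γ_μ(ℓ_A, ℓ_A)`. [folklore] -/
theorem shorDefect_le_card (hρ : Continuous ρ) (μ : Measure (LGConfig d G)) [IsProbabilityMeasure μ] (x : Site d)
    (s : Fin P.nS) :
    P.shorDefect ρ μ x s ≤ P.nI * ∑ A, P.shorVec s A ^ 2 * loopImCov ρ μ x (P.shorLoop A) (P.shorLoop A) := by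
  have h := integral_sq_sum_im_le_card (μ := μ) (P.shorVec s) (t := fun A => loopTrZd ρ x (P.shorLoop A))
    (fun A => aestronglyMeasurable_loopTrZd ρ hρ μ x _) (fun A U => norm_loopTrZd_le_one ρ hρ x _ U)
  simp only [Fintype.card_fin, loopImCov_self_eq] at h ⊢
  exact h

/-- **The generic state transfer** (any compact `G`, continuous `ρ`): if the rows of `P` hold on
the state's data up to `ε_r` and the extra identities hold, then
`obj(W_μ) ≤ bound + Σ_r |y_r| ε_r + Σ_s γ_s(μ)`. [folklore] -/
theorem obj_loopW_le (hP : P.IsValid) (hρ : Continuous ρ) (μ : Measure (LGConfig d G)) [IsProbabilityMeasure μ]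
    (x : Site d) (hgram : ∀ j i, Word.endpointZd x (P.gramWord j i) = x) (ε : Fin P.nR → ℝ)
    (hrow : ∀ r, |planarRow P.βt (P.rowAxis r) (P.rowWord r) (loopW ρ μ x) (loopQ ρ μ x)| ≤ ε r)
    (hlin : ∀ e, P.lin e (loopW ρ μ x) (loopQ ρ μ x) = 0) :
    P.obj (loopW ρ μ x) ≤ P.bound + ∑ r, |P.rowMult r| * ε r + ∑ s, P.shorDefect ρ μ x s :=
  P.obj_le_of_defects hP _ _ ε (P.shorDefect ρ μ x) hrow
    (fun j => gramPairing_loopW_nonneg ρ hρ μ x _ (hgram j) _)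
    (fun s => shorPairing_loopData_ge ρ hρ μ x P.shorLoop (P.shorConst s) (P.shorVec s)) hlin

end States

/-! ## `U(N)`: the defect is the relaxation defect alone -/

/-- ★★★ **A PLANAR CERTIFICATE BOUNDS `U(N)` LATTICE YANG–MILLS AT EVERY FINITE `N`**: for a valid
planar certificate `P` written at 't Hooft coupling `βt = β/N`, every probability Haar-shift state
`μ` of the `U(N)` Wilson action on `ℤ^d` at tree coupling `β` (every DLR state, torus thermodynamic
limit point, Class-B state) whose data satisfies the certificate's identification rows, and all rows
and Gram words closed at the base point `x`:
`obj(W_μ) ≤ bound + Σ_s E_μ(Σ_A m_{sA} Im t_{ℓ_A})²`. [folklore] -/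
theorem obj_loopW_le_uN (hP : P.IsValid) {β : ℝ} (hβ : β / N = P.βt)
    {μ : Measure (LGConfig d (Matrix.unitaryGroup (Fin N) ℂ))} [IsProbabilityMeasure μ]
    (hμ : IsHaarShiftState (unitaryFundamentalRep (Fin N) ℂ) β μ) (x : Site d)
    (hrow : ∀ r, Word.endpointZd x (P.rowWord r) = x) (hgram : ∀ j i, Word.endpointZd x (P.gramWord j i) = x)
    (hlin : ∀ e, P.lin e (loopW (unitaryFundamentalRep (Fin N) ℂ) μ x) (loopQ (unitaryFundamentalRep (Fin N) ℂ) μ x) = 0) :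
    P.obj (loopW (unitaryFundamentalRep (Fin N) ℂ) μ x) ≤
      P.bound + ∑ s, P.shorDefect (unitaryFundamentalRep (Fin N) ℂ) μ x s := by
  have h := P.obj_loopW_le (unitaryFundamentalRep (Fin N) ℂ) hP (continuous_unitaryFundamentalRep (Fin N) ℂ) μ x hgram
    (fun _ => 0) (fun r => by
      rw [← hβ, planarRow_loopData_uN hμ x (P.rowAxis r) (P.rowWord r) (hrow r), abs_zero]) hlin
  simpa using h

/-- ★★ **The crude form**: `obj(W_μ) ≤ bound + Σ_s nI Σ_A m_{sA}² E_μ[(Im t_{ℓ_A})²]` (`U(N)`). [folklore] -/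
theorem obj_loopW_le_uN_card (hP : P.IsValid) {β : ℝ} (hβ : β / N = P.βt)
    {μ : Measure (LGConfig d (Matrix.unitaryGroup (Fin N) ℂ))} [IsProbabilityMeasure μ]
    (hμ : IsHaarShiftState (unitaryFundamentalRep (Fin N) ℂ) β μ) (x : Site d)
    (hrow : ∀ r, Word.endpointZd x (P.rowWord r) = x) (hgram : ∀ j i, Word.endpointZd x (P.gramWord j i) = x)
    (hlin : ∀ e, P.lin e (loopW (unitaryFundamentalRep (Fin N) ℂ) μ x) (loopQ (unitaryFundamentalRep (Fin N) ℂ) μ x) = 0) :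
    P.obj (loopW (unitaryFundamentalRep (Fin N) ℂ) μ x) ≤
      P.bound + ∑ s, P.nI * ∑ A, P.shorVec s A ^ 2 *
        loopImCov (unitaryFundamentalRep (Fin N) ℂ) μ x (P.shorLoop A) (P.shorLoop A) :=
  (P.obj_loopW_le_uN hP hβ hμ x hrow hgram hlin).trans (by
    gcongr with s
    exact P.shorDefect_le_card _ (continuous_unitaryFundamentalRep (Fin N) ℂ) μ x s)

/-! ## `SU(N)`: plus the row defects -/

/-- The `SU(N)` row defect of row `r` on the state `μ`:
`ε_r(μ) = length(w_r)/N² + |βt| Σ_{ν ≠ a_r} Σ_ε |Γ_μ(w_r, P̃_{ν,ε})|`. [folklore] -/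
def rowDefectSuN (μ : Measure (LGConfig d (Matrix.specialUnitaryGroup (Fin N) ℂ))) (x : Site d) (r : Fin P.nR) : ℝ :=
  ((P.rowWord r).length : ℝ) / (N : ℝ) ^ 2 +
    |P.βt| * ∑ ν ∈ Finset.univ.erase (P.rowAxis r), ∑ ε : Bool,
      |loopImCov (fundamentalRep (Fin N)) μ x (P.rowWord r) (plaqWord (P.rowAxis r) ν ε)|

/-- ★★★ **A PLANAR CERTIFICATE BOUNDS `SU(N)` LATTICE YANG–MILLS AT EVERY FINITE `N`**: as for
`U(N)`, with the row defects added: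
`obj(W_μ) ≤ bound + Σ_r |y_r| (length(w_r)/N² + |βt| Σ_{ν,ε} |Γ_μ(w_r, P̃_{ν,ε})|) + Σ_s E_μ(Σ_A m_{sA} Im t_{ℓ_A})²`.
[folklore] -/
theorem obj_loopW_le_suN (hP : P.IsValid) {β : ℝ} (hβ : β / N = P.βt)
    {μ : Measure (LGConfig d (Matrix.specialUnitaryGroup (Fin N) ℂ))} [IsProbabilityMeasure μ]
    (hμ : IsHaarShiftState (fundamentalRep (Fin N)) β μ) (x : Site d)
    (hrow : ∀ r, Word.endpointZd x (P.rowWord r) = x) (hgram : ∀ j i, Word.endpointZd x (P.gramWord j i) = x)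
    (hlin : ∀ e, P.lin e (loopW (fundamentalRep (Fin N)) μ x) (loopQ (fundamentalRep (Fin N)) μ x) = 0) :
    P.obj (loopW (fundamentalRep (Fin N)) μ x) ≤
      P.bound + ∑ r, |P.rowMult r| * P.rowDefectSuN μ x r + ∑ s, P.shorDefect (fundamentalRep (Fin N)) μ x s :=
  P.obj_loopW_le (fundamentalRep (Fin N)) hP (continuous_fundamentalRep (Fin N)) μ x hgram (P.rowDefectSuN μ x)
    (fun r => by
      have h := abs_planarRow_loopData_suN_le hμ x (P.rowAxis r) (P.rowWord r) (hrow r)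
      rw [hβ] at h
      exact h) hlin

/-- ★★ **The crude form** (`SU(N)`), everything in single-loop second moments:
`obj(W_μ) ≤ bound + Σ_r |y_r| ε_r(μ) + Σ_s nI Σ_A m_{sA}² E_μ[(Im t_{ℓ_A})²]`. [folklore] -/
theorem obj_loopW_le_suN_card (hP : P.IsValid) {β : ℝ} (hβ : β / N = P.βt)
    {μ : Measure (LGConfig d (Matrix.specialUnitaryGroup (Fin N) ℂ))} [IsProbabilityMeasure μ]
    (hμ : IsHaarShiftState (fundamentalRep (Fin N)) β μ) (x : Site d)
    (hrow : ∀ r, Word.endpointZd x (P.rowWord r) = x) (hgram : ∀ j i, Word.endpointZd x (P.gramWord j i) = x)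
    (hlin : ∀ e, P.lin e (loopW (fundamentalRep (Fin N)) μ x) (loopQ (fundamentalRep (Fin N)) μ x) = 0) :
    P.obj (loopW (fundamentalRep (Fin N)) μ x) ≤
      P.bound + ∑ r, |P.rowMult r| * P.rowDefectSuN μ x r +
        ∑ s, P.nI * ∑ A, P.shorVec s A ^ 2 * loopImCov (fundamentalRep (Fin N)) μ x (P.shorLoop A) (P.shorLoop A) :=
  (P.obj_loopW_le_suN hP hβ hμ x hrow hgram hlin).trans (by
    gcongr with s
    exact P.shorDefect_le_card _ (continuous_fundamentalRep (Fin N)) μ x s)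

/-! ## Torus thermodynamic limit points and DLR states -/

/-- ★★★ **For every infinite-volume DLR state of `U(N)` lattice Yang–Mills** (every real tree
coupling `β`, every `d`, every `N`): a planar certificate at `βt = β/N` gives
`obj(W_μ) ≤ bound + Σ_s γ_s(μ)`. [folklore] -/
theorem obj_loopW_le_uN_of_mem_ymGibbsMeasures (hP : P.IsValid) {β : ℝ} (hβ : β / N = P.βt)
    {μ : Measure (LGConfig d (Matrix.unitaryGroup (Fin N) ℂ))}
    (hμ : μ ∈ ymGibbsMeasures (d := d) (unitaryFundamentalRep (Fin N) ℂ) β) (x : Site d)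
    (hrow : ∀ r, Word.endpointZd x (P.rowWord r) = x) (hgram : ∀ j i, Word.endpointZd x (P.gramWord j i) = x)
    (hlin : ∀ e, P.lin e (loopW (unitaryFundamentalRep (Fin N) ℂ) μ x) (loopQ (unitaryFundamentalRep (Fin N) ℂ) μ x) = 0) :
    P.obj (loopW (unitaryFundamentalRep (Fin N) ℂ) μ x) ≤
      P.bound + ∑ s, P.shorDefect (unitaryFundamentalRep (Fin N) ℂ) μ x s := by
  haveI : SecondCountableTopology (Matrix (Fin N) (Fin N) ℂ) :=
    inferInstanceAs (SecondCountableTopology (Fin N → Fin N → ℂ))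
  haveI : SecondCountableTopology (Matrix.unitaryGroup (Fin N) ℂ) :=
    Topology.IsEmbedding.subtypeVal.secondCountableTopology
  haveI : IsProbabilityMeasure μ := hμ.1
  exact P.obj_loopW_le_uN hP hβ (isHaarShiftState_of_mem_ymGibbsMeasures (unitaryFundamentalRep (Fin N) ℂ)
    (continuous_unitaryFundamentalRep (Fin N) ℂ) hμ) x hrow hgram hlin

/-- ★★★ **For every infinite-volume DLR state of `SU(N)` lattice Yang–Mills**: a planar certificate at
`βt = β/N` gives `obj(W_μ) ≤ bound + Σ_r |y_r| ε_r(μ) + Σ_s γ_s(μ)`. [folklore] -/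
theorem obj_loopW_le_suN_of_mem_ymGibbsMeasures (hP : P.IsValid) {β : ℝ} (hβ : β / N = P.βt)
    {μ : Measure (LGConfig d (Matrix.specialUnitaryGroup (Fin N) ℂ))}
    (hμ : μ ∈ ymGibbsMeasures (d := d) (fundamentalRep (Fin N)) β) (x : Site d)
    (hrow : ∀ r, Word.endpointZd x (P.rowWord r) = x) (hgram : ∀ j i, Word.endpointZd x (P.gramWord j i) = x)
    (hlin : ∀ e, P.lin e (loopW (fundamentalRep (Fin N)) μ x) (loopQ (fundamentalRep (Fin N)) μ x) = 0) :
    P.obj (loopW (fundamentalRep (Fin N)) μ x) ≤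
      P.bound + ∑ r, |P.rowMult r| * P.rowDefectSuN μ x r + ∑ s, P.shorDefect (fundamentalRep (Fin N)) μ x s := by
  haveI : SecondCountableTopology (Matrix (Fin N) (Fin N) ℂ) :=
    inferInstanceAs (SecondCountableTopology (Fin N → Fin N → ℂ))
  haveI : SecondCountableTopology (Matrix.specialUnitaryGroup (Fin N) ℂ) :=
    Topology.IsEmbedding.subtypeVal.secondCountableTopology
  haveI : IsProbabilityMeasure μ := hμ.1
  exact P.obj_loopW_le_suN hP hβ (isHaarShiftState_of_mem_ymGibbsMeasures (fundamentalRep (Fin N))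
    (continuous_fundamentalRep (Fin N)) hμ) x hrow hgram hlin

/-- ★★★ **For every thermodynamic limit point of the `SU(N)` torus Wilson states**: a planar
certificate at `βt = β/N` gives `obj(W_μ) ≤ bound + Σ_r |y_r| ε_r(μ) + Σ_s γ_s(μ)`. [folklore] -/
theorem obj_loopW_le_suN_of_mem_infiniteVolumeLimitPoints (hP : P.IsValid) {β : ℝ} (hβ : β / N = P.βt)
    {μ : Measure (LGConfig d (Matrix.specialUnitaryGroup (Fin N) ℂ))}
    (hμ : μ ∈ infiniteVolumeLimitPoints (d := d) (fundamentalRep (Fin N)) β) (x : Site d)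
    (hrow : ∀ r, Word.endpointZd x (P.rowWord r) = x) (hgram : ∀ j i, Word.endpointZd x (P.gramWord j i) = x)
    (hlin : ∀ e, P.lin e (loopW (fundamentalRep (Fin N)) μ x) (loopQ (fundamentalRep (Fin N)) μ x) = 0) :
    P.obj (loopW (fundamentalRep (Fin N)) μ x) ≤
      P.bound + ∑ r, |P.rowMult r| * P.rowDefectSuN μ x r + ∑ s, P.shorDefect (fundamentalRep (Fin N)) μ x s := by
  haveI : SecondCountableTopology (Matrix (Fin N) (Fin N) ℂ) :=
    inferInstanceAs (SecondCountableTopology (Fin N → Fin N → ℂ))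
  haveI : SecondCountableTopology (Matrix.specialUnitaryGroup (Fin N) ℂ) :=
    Topology.IsEmbedding.subtypeVal.secondCountableTopology
  exact P.obj_loopW_le_suN_of_mem_ymGibbsMeasures hP hβ
    (mem_ymGibbsMeasures_of_mem_infiniteVolumeLimitPoints_holds (fundamentalRep (Fin N))
      (continuous_fundamentalRep (Fin N)) hμ) x hrow hgram hlin

end PlanarCertificate

end Summit.QuantumFields.GaugeBoot

end
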